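import Summits.QuantumAdvantage.AdviceFreeQNC0.AffBells22FibreSum
import Summits.QuantumAdvantage.AdviceFreeQNC0.AffBells23JuntaProduct
import HarnessLib

/-!
# Sketch22 §2c (frame averaging), step F1 for JUNTA tables: the per-fibre twist bound via LEMMA JPD

The width-one per-fibre bound `AffBells22.norm_fibre_twist_le` (`AffBells22FibreSum`) controls the fibre sum of a frozen
`1`-junta strategy by a coordinate-product argument.  For tables `y_k` reading arbitrary sets `T_k` the fibre sign
`(−1)^{⟨J, stake(y,x)⟩}` factorises as (width-one coordinate product) × (junta product `Π_{b ∈ supp J} sgn y_b(x)`, the factor `b`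
reading the coins in `T_b`) (`fibreSign_eq_prod`), so the planner's LEMMA JPD (`AffBells23.norm_sum_juntaProduct_mul_char_le`,
`AffBells23JuntaProduct`, qn-p1 g23) applies on the fibre for every TRANSVERSAL `A` of the reading sets (`|T_k ∩ A| ≤ 1`):

  `‖Σ_{x odd, J(x)=J} (−1)^{⟨J,stake(y,x)⟩} ω^{⟨γ,x⟩}‖ ≤ Π_{J_i = 0} w_{γ|A}(i)`,  `w_{γ|A} = √3` on `A ∩ supp γ`, `2` elsewhere

(`norm_fibre_twist_le_junta`; the weight is `wtGamma` of the restricted frequency `γ|A`).  Summing over kernel lines and choosing a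
large transversal inside `supp(tV)` (Turán, `AffBells23Transversal`) gives frame averaging for all junta widths
(`AffBells22FrameAveraging`).
-/

namespace Summit.QuantumAdvantage.AdviceFreeQNC0

open Finset Literature.Computability.QuantumComplexity Literature.Computability.QuantumComplexity.RingHLF
open Literature.Computability.MetaComplexity

namespace AffBells22

variable {N : ℕ}

/-! ## The fibre sign of a junta table: width-one part × junta product -/

/-- The fibre sign factorises: `(−1)^{⟨J, stake(y,x)⟩} = (Π_{b ∈ supp J} sgn x_b · sgn x_{b+1}) · Π_{b ∈ supp J} sgn y_b(x)`. -/
theorem fibreSign_eq_prod (J : Fin N → Bool) (y : Fin N → (Fin N → Bool) → Bool) (v : {i // i ∉ act J} → Bool) :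
    (-1 : ℂ) ^ dot2 J (Fib19.stake (fun x k => y k x) (gv J v))
      = (∏ b ∈ act J, (sgnB ((gv J v) b) * sgnB ((gv J v) (nxt b))))
          * ∏ b ∈ act J, sgnB (y b (gv J v)) := by
  unfold dot2
  rw [← neg_one_pow_eq_pow_mod_two]
  have hfilt : (univ.filter fun b : Fin N => J b = true ∧ Fib19.stake (fun x k => y k x) (gv J v) b = true)
      = (act J).filter fun b => Fib19.stake (fun x k => y k x) (gv J v) b = true := by
    unfold act; rw [Finset.filter_filter]
  rw [hfilt, neg_one_pow_card_filter_eq_prod_sgnB, ← prod_mul_distrib]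
  refine prod_congr rfl fun b _ => ?_
  unfold Fib19.stake tGuess
  rw [sgnB_xor, sgnB_xor]
  ring

/-- The width-one part is a coordinate product of the coins. -/
theorem isCoordProduct_fibreSign₀ (J : Fin N → Bool) :
    IsCoordProduct (fun v : {i // i ∉ act J} → Bool =>
      ∏ b ∈ act J, (sgnB ((gv J v) b) * sgnB ((gv J v) (nxt b)))) :=
  isCoordProduct_prod _ _ fun b _ =>
    (isCoordProduct_sgnB_reader J {b} (by simp) (fun x => x b) (readsOnly_apply b)).mul
      (isCoordProduct_sgnB_reader J {nxt b} (by simp) (fun x => x (nxt b)) (readsOnly_apply (nxt b)))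

/-- The reading set of the factor `sgn y_b` as a set of coins: the coins in `T_b`. -/
def coinSet (J : Fin N → Bool) (Tb : Finset (Fin N)) : Finset {i // i ∉ act J} :=
  univ.filter fun p => p.val ∈ Tb

/-- The factor `sgn y_b(x)` reads only the coins in `T_b`. -/
theorem readsOn_sgnB_junta (J : Fin N → Bool) (Tb : Finset (Fin N)) (r : (Fin N → Bool) → Bool)
    (hr : ReadsOnly Tb r) : AffBells23.ReadsOn (coinSet J Tb) (fun v : {i // i ∉ act J} → Bool => sgnB (r (gv J v))) := by
  intro v v' hvv'
  show sgnB (r (gv J v)) = sgnB (r (gv J v'))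
  congr 1
  refine hr _ _ fun i hi => ?_
  unfold gv
  by_cases hiA : i ∈ act J
  · rw [TwoModuli.glue_apply_mem _ _ hiA, TwoModuli.glue_apply_mem _ _ hiA]
  · rw [TwoModuli.glue_apply_not_mem _ _ hiA, TwoModuli.glue_apply_not_mem _ _ hiA]
    exact hvv' ⟨i, hiA⟩ (mem_filter.mpr ⟨mem_univ _, hi⟩)

/-- The coin preimage of a set `A` of positions. -/
def coinPre (J : Fin N → Bool) (A : Finset (Fin N)) : Finset {i // i ∉ act J} :=
  univ.filter fun p => p.val ∈ A

/-- A transversal of the reading sets stays a transversal of the coin sets. -/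
theorem card_coinSet_inter_le (J : Fin N → Bool) (Tb A : Finset (Fin N)) (h : (Tb ∩ A).card ≤ 1) :
    (coinSet J Tb ∩ coinPre J A).card ≤ 1 := by
  rw [Finset.card_le_one] at h ⊢
  intro p hp q hq
  rw [mem_inter] at hp hq
  have hp' : p.val ∈ Tb ∩ A := mem_inter.mpr ⟨(mem_filter.mp hp.1).2, (mem_filter.mp hp.2).2⟩
  have hq' : q.val ∈ Tb ∩ A := mem_inter.mpr ⟨(mem_filter.mp hq.1).2, (mem_filter.mp hq.2).2⟩
  exact Subtype.ext (h _ hp' _ hq')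

/-! ## The per-fibre twist bound for junta tables -/

/-- **PER-FIBRE TWIST BOUND, JUNTA TABLES**: for tables `y_k` reading `T_k` and a TRANSVERSAL `A` of `(T_k)` (`|T_k ∩ A| ≤ 1`),
`‖Σ_{x odd, J(x) = J} (−1)^{⟨J, stake(y,x)⟩} ω^{⟨γ,x⟩}‖ ≤ Π_{i : J_i = 0} w_{γ|A}(i)` (`√3` on `A ∩ supp γ`, `2` elsewhere) — LEMMA JPD
(`AffBells23.norm_sum_juntaProduct_mul_char_le`) on the fibre in place of the width-one bound. -/
theorem norm_fibre_twist_le_junta (hN : 3 ≤ N) {x₀ : Fin N → Bool} (hx₀ : Fib19.IsOdd x₀) (T : Fin N → Finset (Fin N))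
    (y : Fin N → (Fin N → Bool) → Bool) (hy : ∀ k, ReadsOnly (T k) (y k))
    (γ : Fin N → ZMod 3) (A : Finset (Fin N)) (hA : ∀ k, (T k ∩ A).card ≤ 1) :
    ‖∑ x ∈ ((univ : Finset (Fin N → Bool)).filter fun x => Fib19.IsOdd x).filter
        (fun x => Fib19.kline x = Fib19.kline x₀),
        (-1 : ℂ) ^ dot2 (Fib19.kline x) (Fib19.stake (fun x k => y k x) x)
          * (ZMod.stdAddChar (∑ i : Fin N, if x i then γ i else 0) : ℂ)‖
      ≤ wordWt (wtGamma (fun i => if i ∈ A then γ i else 0)) (Fib19.kline x₀) := by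
  set J := Fib19.kline x₀ with hJ
  set γR : Fin N → ZMod 3 := fun i => if i ∈ A then γ i else 0 with hγR
  have hrw : ∑ x ∈ ((univ : Finset (Fin N → Bool)).filter fun x => Fib19.IsOdd x).filter (fun x => Fib19.kline x = J),
      (-1 : ℂ) ^ dot2 (Fib19.kline x) (Fib19.stake (fun x k => y k x) x)
        * (ZMod.stdAddChar (∑ i : Fin N, if x i then γ i else 0) : ℂ)
      = ∑ x ∈ ((univ : Finset (Fin N → Bool)).filter fun x => Fib19.IsOdd x).filter (fun x => Fib19.kline x = J),
      (-1 : ℂ) ^ dot2 J (Fib19.stake (fun x k => y k x) x)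
        * (ZMod.stdAddChar (∑ i : Fin N, if x i then γ i else 0) : ℂ) := by
    refine sum_congr rfl fun x hx => ?_
    rw [(mem_filter.mp hx).2]
  rw [hrw, sum_fibre_eq hN hx₀]
  -- the pieces on the fibre
  set S₀ : ({i // i ∉ act J} → Bool) → ℂ := fun v =>
    ∏ b ∈ act J, (sgnB ((gv J v) b) * sgnB ((gv J v) (nxt b))) with hS₀
  set h : Fin N → ({i // i ∉ act J} → Bool) → ℂ := fun b v => sgnB (y b (gv J v)) with hh
  set P : ({i // i ∉ act J} → Bool) → ℂ := fun v => ∏ i : Fin N, sgnB (!(gv J v) i) with hP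
  have hS₀c : IsCoordProduct S₀ := isCoordProduct_fibreSign₀ J
  have hPc : IsCoordProduct P := isCoordProduct_zerosSign J
  have hpm : ∀ b ∈ act J, ∀ v, h b v = 1 ∨ h b v = -1 := fun b _ v => sgnB_cases _
  have hread : ∀ b ∈ act J, AffBells23.ReadsOn (coinSet J (T b)) (h b) :=
    fun b _ => readsOn_sgnB_junta J (T b) (y b) (hy b)
  have hA' : ∀ b ∈ act J, (coinSet J (T b) ∩ coinPre J A).card ≤ 1 :=
    fun b _ => card_coinSet_inter_le J (T b) A (hA b)
  set cA : ℂ := (ZMod.stdAddChar (∑ k : {i // i ∈ act J}, if forced J k then γ k else 0) : ℂ) with hcA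
  set γ' : {i // i ∉ act J} → ZMod 3 := fun k => γ k with hγ'
  have hterm : ∀ v : {i // i ∉ act J} → Bool,
      (if Fib19.IsOdd (gv J v) then (-1 : ℂ) ^ dot2 J (Fib19.stake (fun x k => y k x) (gv J v))
          * (ZMod.stdAddChar (∑ i : Fin N, if gv J v i then γ i else 0) : ℂ) else 0)
        = cA / 2 * ((S₀ v * ∏ b ∈ act J, h b v) * (ZMod.stdAddChar (∑ k, if v k then γ' k else 0) : ℂ))
          - cA / 2 * (((P v * S₀ v) * ∏ b ∈ act J, h b v)
              * (ZMod.stdAddChar (∑ k, if v k then γ' k else 0) : ℂ)) := by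
    intro v
    have hind := isOdd_indicator_eq (gv J v)
    rw [char_split, AddChar.map_add_eq_mul, fibreSign_eq_prod]
    by_cases ho : Fib19.IsOdd (gv J v)
    · rw [if_pos ho] at hind ⊢
      have hP1 : P v = -1 := by
        have : (1 : ℂ) = (1 - P v) / 2 := hind
        linear_combination 2 * this
      rw [hP1]; simp only [hS₀, hh, hcA, hγ']; ring
    · rw [if_neg ho] at hind ⊢
      have hP1 : P v = 1 := by
        have : (0 : ℂ) = (1 - P v) / 2 := hind
        linear_combination 2 * this
      rw [hP1]; ring
  rw [sum_congr rfl fun v _ => hterm v, sum_sub_distrib, ← mul_sum, ← mul_sum]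
  have hB := AffBells23.norm_sum_juntaProduct_mul_char_le (act J) (fun b => coinSet J (T b)) h hpm hread hS₀c γ'
    (coinPre J A) hA'
  have hB' := AffBells23.norm_sum_juntaProduct_mul_char_le (act J) (fun b => coinSet J (T b)) h hpm hread (hPc.mul hS₀c) γ'
    (coinPre J A) hA'
  have hcAn : ‖cA / 2‖ = 1 / 2 := by
    rw [norm_div, hcA, AffBells21.norm_stdAddChar_three]; simp
  -- the product bound equals the word weight of the restricted frequency
  have hprod : ∏ k : {i // i ∉ act J}, (if k ∈ coinPre J A ∧ γ' k ≠ 0 then Real.sqrt 3 else 2) = wordWt (wtGamma γR) J := by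
    have e1 : ∀ k : {i // i ∉ act J}, (if k ∈ coinPre J A ∧ γ' k ≠ 0 then Real.sqrt 3 else 2)
        = (fun i : Fin N => if γR i ≠ 0 then Real.sqrt 3 else 2) k := by
      intro k
      have hk : (k ∈ coinPre J A) ↔ k.val ∈ A := by simp [coinPre]
      simp only [hγR, hγ', hk]
      by_cases hkA : k.val ∈ A
      · simp [hkA]
      · simp [hkA]
    rw [Fintype.prod_congr _ _ e1]
    unfold wordWt
    rw [← Finset.prod_subtype (p := fun i => i ∉ act J) (act J)ᶜ (fun _ => Finset.mem_compl)
      (f := fun i => if γR i ≠ 0 then Real.sqrt 3 else 2),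
      ← Finset.prod_filter_mul_prod_filter_not univ (fun i => J i = false)]
    have h1 : (act J)ᶜ = (univ.filter fun i : Fin N => J i = false) := by
      ext i; simp [act]
    have h2 : ∏ i ∈ univ.filter (fun i : Fin N => ¬ J i = false),
        (if J i = false then wtGamma γR i.val else 1) = 1 :=
      prod_eq_one fun i hi => by rw [if_neg (mem_filter.mp hi).2]
    rw [h1, h2, mul_one]
    refine prod_congr rfl fun i hi => ?_
    rw [if_pos (mem_filter.mp hi).2, wtGamma_val]
  calc ‖cA / 2 * ∑ v, (S₀ v * ∏ b ∈ act J, h b v) * (ZMod.stdAddChar (∑ k, if v k then γ' k else 0) : ℂ)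
        - cA / 2 * ∑ v, ((P v * S₀ v) * ∏ b ∈ act J, h b v) * (ZMod.stdAddChar (∑ k, if v k then γ' k else 0) : ℂ)‖
      ≤ ‖cA / 2 * ∑ v, (S₀ v * ∏ b ∈ act J, h b v) * (ZMod.stdAddChar (∑ k, if v k then γ' k else 0) : ℂ)‖
        + ‖cA / 2 * ∑ v, ((P v * S₀ v) * ∏ b ∈ act J, h b v)
            * (ZMod.stdAddChar (∑ k, if v k then γ' k else 0) : ℂ)‖ := norm_sub_le _ _
    _ ≤ 1 / 2 * wordWt (wtGamma γR) J + 1 / 2 * wordWt (wtGamma γR) J := by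
        rw [norm_mul, norm_mul, hcAn, ← hprod]
        exact add_le_add (mul_le_mul_of_nonneg_left hB (by norm_num)) (mul_le_mul_of_nonneg_left hB' (by norm_num))
    _ = wordWt (wtGamma γR) J := by ring

end AffBells22

end Summit.QuantumAdvantage.AdviceFreeQNC0
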